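import Summits.PneNP.PneNP.Theorems.KarlinRubinMonotoneBlindStubCoverBound
import Literature.Computability.Complexity.PeresNoiseSensitivity

/-!
# Crux `MonotoneBlind` (stmt-PneNP-18027, route KarlinRubin), line `Sketch`: stub `stub_fairShare`

Single-edge revivals are negligible for EVERY monotone test — the registered stub `stub_fairShare` of line
`Sketch` (vertex-cover duality / witness form, lead c1) of crux stmt-PneNP-18027. For `n k` and a monotone
`f : EdgeVec n → Bool` (pointwise order, `false < true`):

`(#kSubsets)⁻¹ Σ_{A ∈ kSubsets n k} Pr_{G(n,1/2)}[f x = 0 ∧ ∃ e inside A, f (x with e on) = 1]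
   ≤ (d/n)² (⌊√N⌋ + 1)`, `d = min k n`, `N = #E(Kₙ)`

(with `d ≈ n^{1/2-δ}`, `N ≈ n²/2` this is `≈ 0.71 n^{-2δ} → 0`: the `|U| = 2` level of the minimal-completion
cover is free for every monotone function, Kučera's `√n` threshold read off the influence bound).

* `fairShare_sum_card_filter_le` — counting form of `Σ_e Pr_x[f x = 0 ∧ f (x with e on) = 1] ≤ Σ_e Inf_e(f)
  ≤ √N`: a reviving slot is pivotal, swap the two counts, and apply the in-tree unate total-influence bound
  `Literature.Computability.Complexity.unate_sum_card_pivotal_le` (O'Donnell, Ex. 2.23), then `√N ≤ ⌊√N⌋ + 1`;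
* `fairShare_sum_toOuterMeasure_le` — the same in probability form (`erdosRenyiHalf_toOuterMeasure_eq_card_div`);
* `fairShare_inv_mul_card_filter_inside_le` — the fibre factor `Pr_A[e inside A] ≤ (d/n)²`
  (`card_filter_superset_div_le` at the two-element vertex set of `e`, `card_filter_mem_edge`);
* `fairShare_inv_mul_sum_sum_le` — swap the sums over `A` and over the slots inside `A`;
* `stub_fairShare` — union bound over the slots inside `A`, then the three items above.

All `--supports stmt-PneNP-18027`; no definitions.
-/

set_option linter.dupNamespace false -- `Summit.PneNP.PneNP.…` is the layout-mandated namespace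

namespace Summit.PneNP.PneNP.Theorems.MonotoneBlind.VertexCover

open Literature.Computability.Complexity Literature.Probability.RandomGraphs.PlantedClique Filter Finset
open scoped ENNReal Topology Classical

variable {n : ℕ}

/-! ### The influence bound, counting form -/

/-- A reviving slot is pivotal: if `f x = 0` and `f (x with e on) = 1` then `x e = 0`, so flipping the bit `e`
of `x` changes `f`. [folklore] -/
theorem fairShare_card_filter_le_card_filter_pivotal (f : EdgeVec n → Bool)
    (e : (⊤ : SimpleGraph (Fin n)).edgeSet) :
    #(univ.filter fun x : EdgeVec n => f x = false ∧ f (Function.update x e true) = true) ≤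
      #(univ.filter fun x : EdgeVec n => f x ≠ f (Function.update x e (!x e))) := by
  refine card_le_card fun x hx => ?_
  rw [mem_filter] at hx ⊢
  obtain ⟨-, hfx, hfe⟩ := hx
  refine ⟨mem_univ _, ?_⟩
  cases hxe : x e
  · rw [Bool.not_false, hfx, hfe]
    exact Bool.false_ne_true
  · have hx : Function.update x e true = x := by rw [← hxe, Function.update_eq_self]
    rw [hx, hfx] at hfe
    exact absurd hfe Bool.false_ne_true

/-- A monotone test is unate: monotone in every single coordinate. [folklore] -/
theorem fairShare_unate_of_monotone (f : EdgeVec n → Bool) (hf : Monotone f)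
    (j : (⊤ : SimpleGraph (Fin n)).edgeSet) :
    (∀ ω, f (Function.update ω j false) = true → f (Function.update ω j true) = true) ∨
      (∀ ω, f (Function.update ω j true) = true → f (Function.update ω j false) = true) := by
  refine Or.inl fun ω h => ?_
  have hle : f (Function.update ω j false) ≤ f (Function.update ω j true) :=
    hf (update_le_update_iff'.2 (Bool.false_le _))
  rw [h] at hle
  revert hle
  cases f (Function.update ω j true) <;> simp

/-- `#(EdgeVec n) = 2^N`, `N` the number of edge slots of `Kₙ`. [folklore] -/
theorem fairShare_card_edgeVec (n : ℕ) :
    Fintype.card (EdgeVec n) = 2 ^ Fintype.card (⊤ : SimpleGraph (Fin n)).edgeSet := by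
  rw [Fintype.card_fun, Fintype.card_bool]

/-- **Single-edge revivals, counting form.** For a monotone `f`, summed over the slots `e` of `Kₙ`, the inputs
`x` with `f x = 0` but `f (x with e on) = 1` number at most `(⌊√N⌋ + 1) · 2^N` (`N = #E(Kₙ)`): such a slot is
pivotal at `x`, the double count of pivotal pairs is the total influence times `2^N`, and the total influence
of a unate function is `≤ √N` (`unate_sum_card_pivotal_le`, O'Donnell Ex. 2.23). [folklore] -/
theorem fairShare_sum_card_filter_le (f : EdgeVec n → Bool) (hf : Monotone f) :
    ∑ e : (⊤ : SimpleGraph (Fin n)).edgeSet,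
        #(univ.filter fun x : EdgeVec n => f x = false ∧ f (Function.update x e true) = true) ≤
      (Nat.sqrt (Fintype.card (⊤ : SimpleGraph (Fin n)).edgeSet) + 1) * Fintype.card (EdgeVec n) := by
  -- exchange the two counts
  have hswap : ∑ e : (⊤ : SimpleGraph (Fin n)).edgeSet,
      #(univ.filter fun x : EdgeVec n => f x ≠ f (Function.update x e (!x e))) =
      ∑ x : EdgeVec n, #(univ.filter fun e : (⊤ : SimpleGraph (Fin n)).edgeSet =>
        f x ≠ f (Function.update x e (!x e))) := by
    simp only [card_eq_sum_ones, sum_filter]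
    exact sum_comm
  -- the unate bound (over `ℝ`) and `√N ≤ ⌊√N⌋ + 1`
  have hreal : ((∑ x : EdgeVec n, #(univ.filter fun e : (⊤ : SimpleGraph (Fin n)).edgeSet =>
      f x ≠ f (Function.update x e (!x e))) : ℕ) : ℝ) ≤
      ((Nat.sqrt (Fintype.card (⊤ : SimpleGraph (Fin n)).edgeSet) + 1) *
        2 ^ Fintype.card (⊤ : SimpleGraph (Fin n)).edgeSet : ℕ) := by
    push_cast
    refine (unate_sum_card_pivotal_le f (fairShare_unate_of_monotone f hf)).trans ?_
    gcongr
    exact Real.real_sqrt_le_nat_sqrt_succ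
  rw [fairShare_card_edgeVec]
  calc ∑ e : (⊤ : SimpleGraph (Fin n)).edgeSet,
        #(univ.filter fun x : EdgeVec n => f x = false ∧ f (Function.update x e true) = true)
      ≤ ∑ e : (⊤ : SimpleGraph (Fin n)).edgeSet,
          #(univ.filter fun x : EdgeVec n => f x ≠ f (Function.update x e (!x e))) :=
        sum_le_sum fun e _ => fairShare_card_filter_le_card_filter_pivotal f e
    _ = _ := hswap
    _ ≤ _ := by exact_mod_cast hreal

/-! ### Probability forms -/

/-- **Single-edge revivals, probability form**: for a monotone `f`,
`Σ_e Pr_{G(n,1/2)}[f x = 0 ∧ f (x with e on) = 1] ≤ ⌊√N⌋ + 1`. [folklore] -/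
theorem fairShare_sum_toOuterMeasure_le (f : EdgeVec n → Bool) (hf : Monotone f) :
    ∑ e : (⊤ : SimpleGraph (Fin n)).edgeSet,
        (erdosRenyiHalf n).toOuterMeasure {x | f x = false ∧ f (Function.update x e true) = true} ≤
      ((Nat.sqrt (Fintype.card (⊤ : SimpleGraph (Fin n)).edgeSet) + 1 : ℕ) : ℝ≥0∞) := by
  have hcount := fairShare_sum_card_filter_le f hf
  calc ∑ e : (⊤ : SimpleGraph (Fin n)).edgeSet,
        (erdosRenyiHalf n).toOuterMeasure {x | f x = false ∧ f (Function.update x e true) = true}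
      = ∑ e : (⊤ : SimpleGraph (Fin n)).edgeSet,
          ((#(univ.filter fun x : EdgeVec n => f x = false ∧ f (Function.update x e true) = true) : ℕ) :
              ℝ≥0∞) / (Fintype.card (EdgeVec n) : ℝ≥0∞) := by
        refine sum_congr rfl fun e _ => ?_
        rw [erdosRenyiHalf_toOuterMeasure_eq_card_div]
        rfl
    _ = ((∑ e : (⊤ : SimpleGraph (Fin n)).edgeSet,
          #(univ.filter fun x : EdgeVec n => f x = false ∧ f (Function.update x e true) = true) : ℕ) :
            ℝ≥0∞) / (Fintype.card (EdgeVec n) : ℝ≥0∞) := by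
        rw [Nat.cast_sum]
        simp only [div_eq_mul_inv, sum_mul]
    _ ≤ _ := ENNReal.div_le_of_le_mul (by exact_mod_cast hcount)

/-- **Fibre factor for one slot**: `Pr_A[e inside A] ≤ (d/n)²` under the uniform law on `kSubsets n k`
(`d = min k n`): `e` lies inside `A` iff its two-element vertex set is contained in `A`
(`card_filter_superset_div_le`, `card_filter_mem_edge`). [folklore] -/
theorem fairShare_inv_mul_card_filter_inside_le (n k : ℕ) (e : (⊤ : SimpleGraph (Fin n)).edgeSet) :
    ((#(kSubsets n k) : ℕ) : ℝ≥0∞)⁻¹ *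
        ((#((kSubsets n k).filter fun A => ∀ v ∈ (e : Sym2 (Fin n)), v ∈ A) : ℕ) : ℝ≥0∞) ≤
      (((min k n : ℕ) : ℝ≥0∞) / (n : ℝ≥0∞)) ^ 2 := by
  have hfilter : ((kSubsets n k).filter fun A => ∀ v ∈ (e : Sym2 (Fin n)), v ∈ A) =
      (kSubsets n k).filter fun A => (univ.filter fun v : Fin n => v ∈ (e : Sym2 (Fin n))) ⊆ A := by
    refine filter_congr fun A _ => ?_
    simp only [subset_iff, mem_filter, mem_univ, true_and]
  rw [hfilter]
  calc ((#(kSubsets n k) : ℕ) : ℝ≥0∞)⁻¹ *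
        ((#((kSubsets n k).filter fun A =>
          (univ.filter fun v : Fin n => v ∈ (e : Sym2 (Fin n))) ⊆ A) : ℕ) : ℝ≥0∞)
      = ((#((kSubsets n k).filter fun A =>
          (univ.filter fun v : Fin n => v ∈ (e : Sym2 (Fin n))) ⊆ A) : ℕ) : ℝ≥0∞) /
            ((#(kSubsets n k) : ℕ) : ℝ≥0∞) := by
        rw [div_eq_mul_inv, mul_comm]
    _ ≤ (((min k n : ℕ) : ℝ≥0∞) / (n : ℝ≥0∞)) ^ #(univ.filter fun v : Fin n => v ∈ (e : Sym2 (Fin n))) :=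
        card_filter_superset_div_le n k _
    _ = _ := by rw [card_filter_mem_edge]

/-- **Averaging a slot sum over the planted set.** For every `g` on the slots of `Kₙ`,
`(#kSubsets)⁻¹ Σ_{A ∈ kSubsets} Σ_{e inside A} g e ≤ (d/n)² Σ_e g e`: swap the two sums and bound each fibre
`(#kSubsets)⁻¹ #{A | e inside A}` by `fairShare_inv_mul_card_filter_inside_le`. [folklore] -/
theorem fairShare_inv_mul_sum_sum_le (n k : ℕ) (g : (⊤ : SimpleGraph (Fin n)).edgeSet → ℝ≥0∞) :
    ((#(kSubsets n k) : ℕ) : ℝ≥0∞)⁻¹ *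
        ∑ A ∈ kSubsets n k, ∑ e ∈ univ.filter (fun e : (⊤ : SimpleGraph (Fin n)).edgeSet =>
          ∀ v ∈ (e : Sym2 (Fin n)), v ∈ A), g e ≤
      (((min k n : ℕ) : ℝ≥0∞) / (n : ℝ≥0∞)) ^ 2 * ∑ e : (⊤ : SimpleGraph (Fin n)).edgeSet, g e := by
  calc ((#(kSubsets n k) : ℕ) : ℝ≥0∞)⁻¹ *
        ∑ A ∈ kSubsets n k, ∑ e ∈ univ.filter (fun e : (⊤ : SimpleGraph (Fin n)).edgeSet =>
          ∀ v ∈ (e : Sym2 (Fin n)), v ∈ A), g e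
      = ∑ e : (⊤ : SimpleGraph (Fin n)).edgeSet, g e * (((#(kSubsets n k) : ℕ) : ℝ≥0∞)⁻¹ *
          ((#((kSubsets n k).filter fun A => ∀ v ∈ (e : Sym2 (Fin n)), v ∈ A) : ℕ) : ℝ≥0∞)) := by
        simp only [sum_filter]
        rw [sum_comm, mul_sum]
        refine sum_congr rfl fun e _ => ?_
        rw [← sum_filter, sum_const, nsmul_eq_mul]
        ring
    _ ≤ ∑ e : (⊤ : SimpleGraph (Fin n)).edgeSet, g e * (((min k n : ℕ) : ℝ≥0∞) / (n : ℝ≥0∞)) ^ 2 :=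
        sum_le_sum fun e _ => mul_le_mul_right (fairShare_inv_mul_card_filter_inside_le n k e) _
    _ = _ := by rw [← sum_mul, mul_comm]

/-! ### The stub -/

/-- **stub_fairShare** (registered stub of line `Sketch`, crux stmt-PneNP-18027; single-edge revivals are
negligible for EVERY monotone test — the `|U| = 2` level of the minimal-completion cover). For `n k` and
monotone `f`: `(#kSubsets)⁻¹ Σ_A Pr_x[f x = 0 ∧ ∃ e inside A, f (x with e on) = 1] ≤ (d/n)² (⌊√N⌋ + 1)`,
`d = min k n`, `N = #E(Kₙ)`. Proof: union bound over the slots inside `A` (`measure_biUnion_finset_le`); swap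
the sums and bound `Pr_A[e inside A] ≤ (d/n)²` (`fairShare_inv_mul_sum_sum_le`, fibre factor
`card_kSubsets_filter_superset_mul_le` at the 2-set `V(e)`); finally
`Σ_e Pr_x[f x = 0 ∧ f (x with e on) = 1] ≤ Σ_e Inf_e(f) ≤ √N ≤ ⌊√N⌋ + 1` by the in-tree unate bound
`Literature.Computability.Complexity.unate_sum_card_pivotal_le` (`fairShare_sum_toOuterMeasure_le`). With
`d ≈ n^{1/2-δ}`, `N ≈ n²/2`: `≤ 0.71 n^{-2δ} → 0`. [folklore] -/
theorem stub_fairShare :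
    ∀ (n k : ℕ) (f : EdgeVec n → Bool), Monotone f →
      ((#(kSubsets n k) : ℕ) : ℝ≥0∞)⁻¹ *
          ∑ A ∈ kSubsets n k, (erdosRenyiHalf n).toOuterMeasure
            {x | f x = false ∧ ∃ e : (⊤ : SimpleGraph (Fin n)).edgeSet,
              (∀ v ∈ (e : Sym2 (Fin n)), v ∈ A) ∧ f (Function.update x e true) = true} ≤
        ((((min k n : ℕ) : ℝ≥0∞) / (n : ℝ≥0∞)) ^ 2) *
          ((Nat.sqrt (Fintype.card (⊤ : SimpleGraph (Fin n)).edgeSet) + 1 : ℕ) : ℝ≥0∞) := by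
  intro n k f hf
  -- union bound over the slots inside `A`
  have h1 : ∀ A : Finset (Fin n), (erdosRenyiHalf n).toOuterMeasure
      {x | f x = false ∧ ∃ e : (⊤ : SimpleGraph (Fin n)).edgeSet,
        (∀ v ∈ (e : Sym2 (Fin n)), v ∈ A) ∧ f (Function.update x e true) = true} ≤
      ∑ e ∈ univ.filter (fun e : (⊤ : SimpleGraph (Fin n)).edgeSet => ∀ v ∈ (e : Sym2 (Fin n)), v ∈ A),
        (erdosRenyiHalf n).toOuterMeasure {x | f x = false ∧ f (Function.update x e true) = true} := by
    intro A
    calc (erdosRenyiHalf n).toOuterMeasure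
          {x | f x = false ∧ ∃ e : (⊤ : SimpleGraph (Fin n)).edgeSet,
            (∀ v ∈ (e : Sym2 (Fin n)), v ∈ A) ∧ f (Function.update x e true) = true}
        ≤ (erdosRenyiHalf n).toOuterMeasure
            (⋃ e ∈ univ.filter (fun e : (⊤ : SimpleGraph (Fin n)).edgeSet =>
                ∀ v ∈ (e : Sym2 (Fin n)), v ∈ A),
              {x | f x = false ∧ f (Function.update x e true) = true}) := by
          refine (erdosRenyiHalf n).toOuterMeasure.mono fun x hx => ?_
          obtain ⟨hfx, e, heA, hfe⟩ := hx
          exact Set.mem_biUnion (mem_filter.2 ⟨mem_univ e, heA⟩) ⟨hfx, hfe⟩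
      _ ≤ _ := MeasureTheory.measure_biUnion_finset_le _ _
  calc ((#(kSubsets n k) : ℕ) : ℝ≥0∞)⁻¹ *
        ∑ A ∈ kSubsets n k, (erdosRenyiHalf n).toOuterMeasure
          {x | f x = false ∧ ∃ e : (⊤ : SimpleGraph (Fin n)).edgeSet,
            (∀ v ∈ (e : Sym2 (Fin n)), v ∈ A) ∧ f (Function.update x e true) = true}
      ≤ ((#(kSubsets n k) : ℕ) : ℝ≥0∞)⁻¹ *
          ∑ A ∈ kSubsets n k, ∑ e ∈ univ.filter (fun e : (⊤ : SimpleGraph (Fin n)).edgeSet =>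
              ∀ v ∈ (e : Sym2 (Fin n)), v ∈ A),
            (erdosRenyiHalf n).toOuterMeasure {x | f x = false ∧ f (Function.update x e true) = true} :=
        mul_le_mul_right (sum_le_sum fun A _ => h1 A) _
    _ ≤ (((min k n : ℕ) : ℝ≥0∞) / (n : ℝ≥0∞)) ^ 2 *
          ∑ e : (⊤ : SimpleGraph (Fin n)).edgeSet,
            (erdosRenyiHalf n).toOuterMeasure {x | f x = false ∧ f (Function.update x e true) = true} :=
        fairShare_inv_mul_sum_sum_le n k _
    _ ≤ _ := mul_le_mul_right (fairShare_sum_toOuterMeasure_le f hf) _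

end Summit.PneNP.PneNP.Theorems.MonotoneBlind.VertexCover
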